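import Literature.MathematicalPhysics.QuantumManyBody.PeriodicBoseGasLocalization
import HarnessLib

/-!
# The zero-energy radial scattering equation `u'' = ½ w u` (definitions)

Topic `Literature/MathematicalPhysics/QuantumManyBody`, sibling of `PeriodicBoseGasLocalization.lean`
(provefact `Literature.MathematicalPhysics.QuantumManyBody.BoseGas.Fournais2020_condensation`; named fact `LSSY2005_scatteringSolution`,
[LSSY2005, App. C, Thm. C.1] / [Fournais2020, App. A]). For a radial potential profile
`w : ℝ → ℝ≥0∞` (`w(r)` the value at radius `r`), the scattering solution `1 - ω = f₀(|x|)/|x|·…`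
of `(-Δ + ½w)(1 - ω) = 0` is built from the *regular zero-energy radial solution* `u`, the
solution of `u'' = ½ w u`, `u(0) = 0`, `u'(0) = 1`, i.e. of the Volterra equation
`u(r) = r + ½∫_0^r (r - s) w(s) u(s) ds` [LSSY2005, (2.4)–(2.5): "`a = lim_{r→∞} r - u₀(r)/u₀'(r)`"].

This file only *defines* the objects; their theory (finiteness for bounded potentials of finite
range, the integral identities, the scattering equation in `𝒟'(ℝ³)`, the variational
characterisation `a = scatteringLength`, monotonicity in the potential and the passage to the limit
through the truncations `min(v, N)` of an integrable `v`) is developed in the sibling proof files.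

* `radialIter w k` — the Picard iterates of the Volterra equation in `[0, ∞]` (all terms are
  non-negative, so the iteration is monotone);
* `radialSolE w = ⨆ₖ radialIter w k` and its real version `radialSol w` (`u`), with the
  derivative `radialSolDeriv w r = 1 + ½∫_0^r w u` (`u'`);
* `odeScatteringLength w R = R - u(R)/u'(R)` — the scattering length read off at a radius `R`
  beyond the range of `w` (there `u` is affine, `u(r) = u'(R)(r - a)`) [LSSY2005, (2.5)];
* `radialProfile w R r = u(r)/(u'(R) r)` (`= 1 - a/r` beyond `R`, value `1/u'(R)` for `r ≤ 0`),
  the normalised profile `f₀(r)/r` of [LSSY2005, Thm. C.1], and its radialisation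
  `scatteringProfile w R x = radialProfile w R |x|`; `scatteringOmega w R = 1 - scatteringProfile w R`
  [Fournais2020, App. A (A.1)–(A.2)];
* `truncPotential v N = min(v, N)` — the bounded truncations of a general (integrable, possibly
  unbounded or a.e.-finite) potential, for which the Volterra iteration is finite; and
  `scatteringProfileLim v R x = inf_N scatteringProfile (min(v,N)) R x`, the monotone limit of the
  truncated profiles (they decrease as the potential increases), whose complement
  `1 - scatteringProfileLim v R` is the scattering solution `ω` of `v` produced in the proof of
  `LSSY2005_scatteringSolution` (sibling proof files).

## References

* [LSSY2005] E. H. Lieb, R. Seiringer, J. P. Solovej, J. Yngvason, *The Mathematics of the Bose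
  Gas and its Condensation*, Birkhäuser 2005, arXiv:cond-mat/0610117: (2.4)–(2.5), App. C Thm. C.1.
* [Fournais2020] S. Fournais, *Length scales for BEC in the dilute Bose gas*, arXiv:2011.00309:
  App. A (A.1)–(A.5).
-/

noncomputable section

open MeasureTheory Set
open scoped ENNReal NNReal

namespace Literature.MathematicalPhysics.QuantumManyBody.BoseGas

/-! ### The Volterra iteration -/

/-- The **Picard iterates** of the zero-energy radial equation in integral form,
`u₀(r) = r`, `u_{k+1}(r) = r + ½∫_0^r (r - s) w(s) u_k(s) ds`, valued in `[0, ∞]`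
(`0` for `r ≤ 0`). [cite: LSSY2005, (2.4)–(2.5)] -/
def radialIter (w : ℝ → ℝ≥0∞) : ℕ → ℝ → ℝ≥0∞
  | 0 => fun r => ENNReal.ofReal r
  | k + 1 => fun r => ENNReal.ofReal r +
      ∫⁻ s in Ioc 0 r, ENNReal.ofReal (r - s) * (2⁻¹ * w s) * radialIter w k s

/-- The **regular zero-energy radial solution** `u = supₖ u_k` in `[0, ∞]`: for potentials with
`∫_0^∞ s w(s) ds < ∞` it is finite and solves `u(r) = r + ½∫_0^r (r-s) w(s) u(s) ds`, i.e.
`u'' = ½wu`, `u(0) = 0`, `u'(0) = 1`. [cite: LSSY2005, (2.4)–(2.5)] -/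
def radialSolE (w : ℝ → ℝ≥0∞) (r : ℝ) : ℝ≥0∞ :=
  ⨆ k, radialIter w k r

/-- The regular zero-energy radial solution `u(r)` as a real number. [cite: LSSY2005, (2.4)–(2.5)] -/
def radialSol (w : ℝ → ℝ≥0∞) (r : ℝ) : ℝ :=
  (radialSolE w r).toReal

/-- The derivative `u'(r) = 1 + ½∫_0^r w(s) u(s) ds` of the regular radial solution.
[cite: LSSY2005, (2.4)–(2.5)] -/
def radialSolDeriv (w : ℝ → ℝ≥0∞) (r : ℝ) : ℝ :=
  1 + (∫⁻ s in Ioc 0 r, 2⁻¹ * w s * radialSolE w s).toReal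

/-! ### The scattering length and the scattering solution read off at a radius `R` -/

/-- The **scattering length from the radial solution**, read off at the radius `R`:
`a = R - u(R)/u'(R)` ("`a = lim_{r→∞} r - u₀(r)/u₀'(r)`"; beyond the range of `w` the
solution is affine, `u(r) = u'(R)(r - a)`, and the expression does not depend on `R`).
[cite: LSSY2005, (2.5)] -/
def odeScatteringLength (w : ℝ → ℝ≥0∞) (R : ℝ) : ℝ :=
  R - radialSol w R / radialSolDeriv w R

/-- The **radial scattering profile** `f(r) = u(r)/(u'(R) r)` (normalised by the slope `u'(R)` at a
radius `R` beyond the range, so that `f = 1 - a/r` there and `f → 1` at infinity), extended by its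
limit `1/u'(R) = lim_{r→0⁺} f(r)` to `r ≤ 0`. This is `f₀(r)/r` of LSSY normalised at infinity.
[cite: LSSY2005, App. C Thm. C.1 and (2.4)–(2.5)] -/
def radialProfile (w : ℝ → ℝ≥0∞) (R : ℝ) (r : ℝ) : ℝ :=
  if r ≤ 0 then (radialSolDeriv w R)⁻¹ else radialSol w r / (radialSolDeriv w R * r)

/-- The **scattering profile** `φ₀(x) = f(|x|) = u(|x|)/(u'(R)|x|)` on `ℝ³` (value `1/u'(R)` at the
origin), i.e. `1 - ω`. [cite: LSSY2005, App. C Thm. C.1; Fournais2020, App. A (A.1)] -/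
def scatteringProfile (w : ℝ → ℝ≥0∞) (R : ℝ) (x : Space) : ℝ :=
  radialProfile w R ‖x‖

/-- The candidate scattering solution `ω = 1 - φ₀`. [cite: Fournais2020, App. A (A.1)–(A.2)] -/
def scatteringOmega (w : ℝ → ℝ≥0∞) (R : ℝ) (x : Space) : ℝ :=
  1 - scatteringProfile w R x

/-! ### Truncations of a general potential and the limiting profile -/

/-- The **bounded truncations** `v_N = min(v, N)` of a potential profile `v : ℝ → [0, ∞]`
(`v_N ↑ v`; each `v_N` is bounded, so its Volterra iteration is finite). [folklore] -/
def truncPotential (v : ℝ → ℝ≥0∞) (N : ℕ) (r : ℝ) : ℝ≥0∞ :=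
  min (v r) N

/-- The **limiting scattering profile** `φ₀ = inf_N φ₀^{(N)}` of a general potential `v`, the
infimum (= pointwise limit: the profiles decrease as the potential increases) of the profiles of
the truncations `min(v, N)`, all normalised at the same radius `R` beyond the range. For `v` of
finite range with `∫_{ℝ³} v < ∞`, `ω = 1 - scatteringProfileLim v R` is the scattering solution of
`IsScatteringSolution v` (proved in the sibling proof files). [cite: LSSY2005, App. C Thm. C.1;
Fournais2020, App. A (A.1)–(A.5)] -/
def scatteringProfileLim (v : ℝ → ℝ≥0∞) (R : ℝ) (x : Space) : ℝ :=
  ⨅ N : ℕ, scatteringProfile (truncPotential v N) R x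

/-! ### Basic API -/

/-- `u₀(r) = r⁺`. [cite: LSSY2005, (2.4)] -/
@[simp] theorem radialIter_zero (w : ℝ → ℝ≥0∞) (r : ℝ) : radialIter w 0 r = ENNReal.ofReal r := rfl

/-- `u_{k+1}(r) = r + ½∫_0^r (r-s) w(s) u_k(s) ds`. [cite: LSSY2005, (2.4)] -/
theorem radialIter_succ (w : ℝ → ℝ≥0∞) (k : ℕ) (r : ℝ) :
    radialIter w (k + 1) r = ENNReal.ofReal r +
      ∫⁻ s in Ioc 0 r, ENNReal.ofReal (r - s) * (2⁻¹ * w s) * radialIter w k s := rfl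

/-- The iterates vanish for `r ≤ 0`. [cite: LSSY2005, (2.4)] -/
theorem radialIter_of_nonpos (w : ℝ → ℝ≥0∞) (k : ℕ) {r : ℝ} (hr : r ≤ 0) : radialIter w k r = 0 := by
  cases k with
  | zero => simp [ENNReal.ofReal_eq_zero.mpr hr]
  | succ k => simp [radialIter_succ, ENNReal.ofReal_eq_zero.mpr hr, Ioc_eq_empty (not_lt.mpr hr)]

/-- `r ≤ u_k(r)`. [cite: LSSY2005, (2.4)] -/
theorem ofReal_le_radialIter (w : ℝ → ℝ≥0∞) (k : ℕ) (r : ℝ) : ENNReal.ofReal r ≤ radialIter w k r := by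
  cases k with
  | zero => exact le_rfl
  | succ k => exact le_self_add

/-- **The iteration is monotone**: `u_k ≤ u_{k+1}` (all terms are non-negative).
[cite: LSSY2005, (2.4)] -/
theorem radialIter_le_succ (w : ℝ → ℝ≥0∞) : ∀ (k : ℕ) (r : ℝ), radialIter w k r ≤ radialIter w (k + 1) r
  | 0, r => le_self_add
  | k + 1, r => by
      rw [radialIter_succ, radialIter_succ]
      gcongr with s
      exact radialIter_le_succ w k s

/-- The iterates increase with `k`. [cite: LSSY2005, (2.4)] -/
theorem monotone_radialIter (w : ℝ → ℝ≥0∞) (r : ℝ) : Monotone fun k => radialIter w k r :=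
  monotone_nat_of_le_succ fun k => radialIter_le_succ w k r

/-- The iterates increase with the potential. [cite: LSSY2005, (2.4)] -/
theorem radialIter_mono {w w' : ℝ → ℝ≥0∞} (h : ∀ r, w r ≤ w' r) :
    ∀ (k : ℕ) (r : ℝ), radialIter w k r ≤ radialIter w' k r
  | 0, _ => le_rfl
  | k + 1, r => by
      rw [radialIter_succ, radialIter_succ]
      gcongr with s
      · exact h s
      · exact radialIter_mono h k s

/-- The iterates are measurable. [cite: LSSY2005, (2.4)] -/
theorem measurable_radialIter {w : ℝ → ℝ≥0∞} (hw : Measurable w) : ∀ k, Measurable (radialIter w k)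
  | 0 => ENNReal.measurable_ofReal
  | k + 1 => by
      have hk := measurable_radialIter hw k
      have hF : Measurable fun p : ℝ × ℝ =>
          (Ioc 0 p.1).indicator (fun s => ENNReal.ofReal (p.1 - s) * (2⁻¹ * w s) * radialIter w k s) p.2 := by
        refine Measurable.indicator ?_ ?_
        · exact ((ENNReal.measurable_ofReal.comp (measurable_fst.sub measurable_snd)).mul
            ((hw.comp measurable_snd).const_mul _)).mul (hk.comp measurable_snd)
        · exact measurableSet_lt measurable_const measurable_snd |>.inter
            (measurableSet_le measurable_snd measurable_fst)
      have h := hF.lintegral_prod_right' (ν := (volume : Measure ℝ))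
      refine ENNReal.measurable_ofReal.add ?_
      convert h using 1
      funext r
      rw [← lintegral_indicator measurableSet_Ioc]

/-- `u` is measurable. [cite: LSSY2005, (2.4)] -/
theorem measurable_radialSolE {w : ℝ → ℝ≥0∞} (hw : Measurable w) : Measurable (radialSolE w) :=
  Measurable.iSup (measurable_radialIter hw)

/-- `u_k ≤ u`. [cite: LSSY2005, (2.4)] -/
theorem radialIter_le_radialSolE (w : ℝ → ℝ≥0∞) (k : ℕ) (r : ℝ) : radialIter w k r ≤ radialSolE w r :=
  le_iSup (fun k => radialIter w k r) k

/-- `r ≤ u(r)`. [cite: LSSY2005, (2.4)] -/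
theorem ofReal_le_radialSolE (w : ℝ → ℝ≥0∞) (r : ℝ) : ENNReal.ofReal r ≤ radialSolE w r :=
  (ofReal_le_radialIter w 0 r).trans (radialIter_le_radialSolE w 0 r)

/-- `u(r) = 0` for `r ≤ 0`. [cite: LSSY2005, (2.4)] -/
theorem radialSolE_of_nonpos (w : ℝ → ℝ≥0∞) {r : ℝ} (hr : r ≤ 0) : radialSolE w r = 0 := by
  simp [radialSolE, radialIter_of_nonpos w _ hr]

/-- `u` increases with the potential. [cite: LSSY2005, (2.4)] -/
theorem radialSolE_mono {w w' : ℝ → ℝ≥0∞} (h : ∀ r, w r ≤ w' r) (r : ℝ) :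
    radialSolE w r ≤ radialSolE w' r :=
  iSup_mono fun k => radialIter_mono h k r

/-! ### The free case `w = 0`: `u(r) = r`, `u' = 1`, `a = 0`, `φ₀ = 1` -/

/-- For `w = 0` every iterate is `u_k(r) = r`. [cite: LSSY2005, (2.4)] -/
theorem radialIter_zero_pot (k : ℕ) (r : ℝ) : radialIter (fun _ => 0) k r = ENNReal.ofReal r := by
  cases k with
  | zero => rfl
  | succ k => simp [radialIter_succ]

/-- For `w = 0`, `u(r) = r⁺`. [cite: LSSY2005, (2.4)] -/
theorem radialSolE_zero_pot (r : ℝ) : radialSolE (fun _ => 0) r = ENNReal.ofReal r := by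
  simp [radialSolE, radialIter_zero_pot]

/-- For `w = 0`, `u'(r) = 1`. [cite: LSSY2005, (2.4)] -/
theorem radialSolDeriv_zero_pot (r : ℝ) : radialSolDeriv (fun _ => 0) r = 1 := by
  simp [radialSolDeriv]

/-- For `w = 0` the scattering length vanishes. [cite: LSSY2005, (2.5)] -/
theorem odeScatteringLength_zero_pot {R : ℝ} (hR : 0 ≤ R) : odeScatteringLength (fun _ => 0) R = 0 := by
  simp [odeScatteringLength, radialSol, radialSolE_zero_pot, radialSolDeriv_zero_pot, ENNReal.toReal_ofReal hR]

/-- For `w = 0` the profile is identically `1`. [cite: LSSY2005, App. C Thm. C.1] -/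
theorem radialProfile_zero_pot (R r : ℝ) : radialProfile (fun _ => 0) R r = 1 := by
  rcases le_or_gt r 0 with hr | hr
  · simp [radialProfile, hr, radialSolDeriv_zero_pot]
  · rw [radialProfile, if_neg (not_le.mpr hr), radialSol, radialSolE_zero_pot, radialSolDeriv_zero_pot,
      ENNReal.toReal_ofReal hr.le, one_mul, div_self hr.ne']

/-- `ω = 1 - φ₀`. [cite: Fournais2020, App. A (A.1)] -/
theorem one_sub_scatteringOmega (w : ℝ → ℝ≥0∞) (R : ℝ) (x : Space) :
    1 - scatteringOmega w R x = scatteringProfile w R x := by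
  rw [scatteringOmega, sub_sub_cancel]

/-- The radial profile at positive radius. [cite: LSSY2005, App. C Thm. C.1] -/
theorem radialProfile_of_pos (w : ℝ → ℝ≥0∞) (R : ℝ) {r : ℝ} (hr : 0 < r) :
    radialProfile w R r = radialSol w r / (radialSolDeriv w R * r) := by
  rw [radialProfile, if_neg (not_le.mpr hr)]

/-- The radial profile at non-positive argument (the value at the origin). [cite: LSSY2005, App. C Thm. C.1] -/
theorem radialProfile_of_nonpos (w : ℝ → ℝ≥0∞) (R : ℝ) {r : ℝ} (hr : r ≤ 0) :
    radialProfile w R r = (radialSolDeriv w R)⁻¹ := by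
  rw [radialProfile, if_pos hr]

/-- `φ₀` away from the origin. [cite: LSSY2005, App. C Thm. C.1] -/
theorem scatteringProfile_of_ne_zero (w : ℝ → ℝ≥0∞) (R : ℝ) {x : Space} (hx : x ≠ 0) :
    scatteringProfile w R x = radialSol w ‖x‖ / (radialSolDeriv w R * ‖x‖) := by
  rw [scatteringProfile, radialProfile_of_pos w R (norm_pos_iff.mpr hx)]

/-- `φ₀(0) = 1/u'(R)`. [cite: LSSY2005, App. C Thm. C.1] -/
theorem scatteringProfile_zero (w : ℝ → ℝ≥0∞) (R : ℝ) :
    scatteringProfile w R 0 = (radialSolDeriv w R)⁻¹ := by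
  rw [scatteringProfile, norm_zero, radialProfile_of_nonpos w R le_rfl]

/-- `φ₀` is radial. [cite: LSSY2005, App. C Thm. C.1] -/
theorem scatteringProfile_radial (w : ℝ → ℝ≥0∞) (R : ℝ) {x y : Space} (h : ‖x‖ = ‖y‖) :
    scatteringProfile w R x = scatteringProfile w R y := by
  rw [scatteringProfile, scatteringProfile, h]

/-- The limiting profile is radial. [cite: LSSY2005, App. C Thm. C.1] -/
theorem scatteringProfileLim_radial (v : ℝ → ℝ≥0∞) (R : ℝ) {x y : Space} (h : ‖x‖ = ‖y‖) :
    scatteringProfileLim v R x = scatteringProfileLim v R y := by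
  simp only [scatteringProfileLim, scatteringProfile, h]

/-- `v_N ≤ v`. [folklore] -/
theorem truncPotential_le (v : ℝ → ℝ≥0∞) (N : ℕ) (r : ℝ) : truncPotential v N r ≤ v r :=
  min_le_left _ _

/-- `v_N ≤ N`: the truncations are bounded. [folklore] -/
theorem truncPotential_le_nat (v : ℝ → ℝ≥0∞) (N : ℕ) (r : ℝ) : truncPotential v N r ≤ N :=
  min_le_right _ _

/-- `v_N` increases with `N`. [folklore] -/
theorem monotone_truncPotential (v : ℝ → ℝ≥0∞) (r : ℝ) : Monotone fun N => truncPotential v N r :=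
  fun _ _ h => min_le_min_left _ (by exact_mod_cast h)

/-- `sup_N v_N = v`. [folklore] -/
theorem iSup_truncPotential (v : ℝ → ℝ≥0∞) (r : ℝ) : ⨆ N : ℕ, truncPotential v N r = v r := by
  refine le_antisymm (iSup_le fun N => truncPotential_le v N r) ?_
  rcases eq_or_ne (v r) ⊤ with h | h
  · rw [h, top_le_iff, iSup_eq_top]
    intro b hb
    obtain ⟨N, hN⟩ := ENNReal.exists_nat_gt hb.ne
    exact ⟨N, lt_min (h ▸ hb) hN⟩
  · obtain ⟨N, hN⟩ := ENNReal.exists_nat_gt h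
    exact le_iSup_of_le N (le_min le_rfl hN.le)

/-- The truncations vanish where `v` does (same range). [folklore] -/
theorem truncPotential_eq_zero {v : ℝ → ℝ≥0∞} {r : ℝ} (h : v r = 0) (N : ℕ) : truncPotential v N r = 0 := by
  rw [truncPotential, h]
  exact min_eq_left bot_le

/-- The truncations are measurable. [folklore] -/
theorem measurable_truncPotential {v : ℝ → ℝ≥0∞} (hv : Measurable v) (N : ℕ) :
    Measurable (truncPotential v N) :=
  hv.min measurable_const

end Literature.MathematicalPhysics.QuantumManyBody.BoseGas

end
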